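import Mathlib
import Summits.QuantumFields.YangMills.Theorems.FradkinShenkerFlowFiniteSusceptibilityWeakCouplingRPCauchySchwarz
import Literature.MathematicalPhysics.QuantumFieldTheory.ConstructiveQFTWave0Proofs
import Literature.MathematicalPhysics.QuantumFieldTheory.ConstructiveQFTWave0SiteRPProofs
import Literature.MathematicalPhysics.QuantumFieldTheory.ConstructiveQFTWave0OddRPProofs
import Literature.MathematicalPhysics.QuantumFieldTheory.WilsonSiteRPForm
import Literature.MathematicalPhysics.QuantumFieldTheory.LatticeGaugeProofs
import HarnessLib

/-!
# `AxialLogConvexity` (item `stmt-QuantumFields-8940`, routes `DirichletWindow` /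
# `XiCompleteMonotonicity` of `YangMills`) — I: reflection positivity on the torus

Helper file (supports `stmt-QuantumFields-8940`; the item is closed in
`DirichletWindowAxialLogConvexity`). On the discrete torus `(ℤ/Mℤ)⁴` with Wilson's measure
`μ_{β,M} = wilsonMeasure ρ β` consider the plaquette observables
`P_x(U) = WilsonRP.plaqRe ρ U (x, q) = Re tr ρ(U_{(x,q)})` of a temporal plane `q = (0, j)`
based at the axial sites `x = c e₀ = Pi.single 0 c`, and their axial covariance
`A_M(c) = Cov_{β,M}(P_0, P_{c e₀})`. No definition is introduced: `A_M` enters through the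
characterising hypothesis `hA : ∀ c, A c = Cov(P_0, P_{c e₀})` of a section variable `A`.

* **Translation invariance** (`wilsonMeasure_map_torusConfigShift`):
  `Cov(P_{a e₀}, P_{b e₀}) = A_M(b - a)` (`cov_axis_eq_tcov`), `A_M(-c) = A_M(c)` (`tcov_neg`),
  `A_M(c) ≤ A_M(0)` (`tcov_le_tcov_zero`, from `Var(X - Y) ≥ 0`).
* **Reflection positivity ⇒ Cauchy–Schwarz** (`tcov_rp`): for a measure-preserving involution
  `Θ` of the torus Wilson state that is reflection positive on a cone containing the axial
  plaquette observables and maps `P_{a e₀} ∘ Θ = P_{φ(a) e₀}`, the abstract centred inequality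
  `RPCauchySchwarz.covariance_rp_cauchySchwarz` gives `0 ≤ A_M(a - φ a)` and
  `A_M(b - φ a)² ≤ A_M(a - φ a) A_M(b - φ b)`.
* **The three cones of the tree**: link hyperplanes of the even torus
  (`wilsonExpectation_reflectionPositive_holds`, `β ≥ 0`; `tcov_link_even`:
  `A(s+t)² ≤ A(2s) A(2t)`), site hyperplanes of the even torus
  (`wilsonExpectation_siteReflectionPositive`; `tcov_site_even`: `A(s+t+1)² ≤ A(2s+1) A(2t+1)`),
  and the mixed reflection of the odd torus (`wilsonExpectation_oddReflectionPositive`, `β ≥ 0`;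
  `tcov_odd`).

References: K. Osterwalder, E. Seiler, Ann. Phys. 110 (1978) 440, §2; E. Seiler, LNP 159 (1982)
Ch. 2; J. Fröhlich, R. Israel, E. Lieb, B. Simon, Comm. Math. Phys. 62 (1978) 1, Thm. 2.1;
S. Chatterjee, arXiv:1803.01950, Problem 5.1.
-/

noncomputable section

open MeasureTheory ProbabilityTheory Filter Topology
open scoped ComplexOrder
open Literature.MathematicalPhysics.QuantumFieldTheory
open Summit.QuantumFields.YangMills.Theorems.FiniteSusceptibilityWeakCoupling

namespace Summit.QuantumFields.YangMills.Theorems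

namespace AxialLogConvexity

variable {G : Type*} [Group G] [TopologicalSpace G] [IsTopologicalGroup G] [CompactSpace G]
  [MeasurableSpace G] [BorelSpace G] {N : ℕ} (ρ : G →* Matrix (Fin N) (Fin N) ℂ)

/-! ### Torus layer: temporal plaquettes on the time axis

Throughout, `q` is a coordinate plane `(i, j)`, `i < j`, and the lemmas that need it assume
`hq : q.1.1 = 0` (a temporal plane); the plaquette observable is the tree's
`WilsonRP.plaqRe ρ U (x, q) = Re tr ρ(U_{(x,q)})`, and the axial sites are `Pi.single 0 c = c e₀`. -/

section Torus

variable {M : ℕ} {q : {p : Fin 4 × Fin 4 // p.1 < p.2}}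

omit [CompactSpace G] in
/-- The plaquette observable is measurable. [folklore] -/
theorem measurable_tplaq (hρ : Continuous ρ) (x : Site 4 M) :
    Measurable fun U : GaugeConfig 4 M G => WilsonRP.plaqRe ρ U (x, q) :=
  WilsonRP.measurable_plaqRe ρ hρ (x, q)

omit [TopologicalSpace G] [IsTopologicalGroup G] [CompactSpace G] [BorelSpace G] in
/-- Translating the configuration translates the plaquette. [folklore] -/
theorem tplaq_torusConfigShift (v x : Site 4 M) (U : GaugeConfig 4 M G) :
    WilsonRP.plaqRe ρ (torusConfigShift v U) (x, q) = WilsonRP.plaqRe ρ U (x - v, q) := by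
  simp only [WilsonRP.plaqRe, plaquetteHolonomy_torusConfigShift]

/-- Differences of axial sites. [folklore] -/
theorem axis_sub_axis (a b : ZMod M) :
    (Pi.single 0 a : Site 4 M) - (Pi.single 0 b : Site 4 M) = Pi.single 0 (a - b) := by
  funext k
  by_cases hk : k = 0
  · subst hk; simp
  · simp [hk]

/-- The time coordinate of the axial site `c e₀` is `c`. [folklore] -/
theorem axis_apply_zero (c : ZMod M) : (Pi.single 0 c : Site 4 M) 0 = c := by
  simp

/-- The spatial coordinates of an axial site vanish. [folklore] -/
theorem axis_apply_of_ne (c : ZMod M) {k : Fin 4} (hk : k ≠ 0) : (Pi.single 0 c : Site 4 M) k = 0 := by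
  simp [hk]

/-- The reflected axial plaquette for the link reflection `θ t = 1 - t`: the plaquette
`[c, c+1]` goes to `[-c, -c+1]`. [folklore] -/
theorem timeReflect_shift_axis (c : ZMod M) :
    (Site.shift (Pi.single 0 c : Site 4 M) 0).timeReflect = Pi.single 0 (-c) := by
  funext k
  by_cases hk : k = 0
  · subst hk
    rw [WilsonRP.timeReflect_apply_zero, WilsonRP.shift_apply_self, axis_apply_zero, axis_apply_zero]
    ring
  · rw [WilsonRP.timeReflect_apply_of_ne _ hk, WilsonRP.shift_apply_of_ne _ hk,
      axis_apply_of_ne c hk, axis_apply_of_ne (-c) hk]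

/-- The reflected axial plaquette for the site reflection `θ' t = -t`: the plaquette `[c, c+1]`
goes to `[-c-1, -c]`. [folklore] -/
theorem negReflect_shift_axis (c : ZMod M) :
    (Site.shift (Pi.single 0 c : Site 4 M) 0).negReflect = Pi.single 0 (-(c + 1)) := by
  funext k
  by_cases hk : k = 0
  · subst hk
    rw [WilsonSiteRP.negReflect_apply_zero, WilsonRP.shift_apply_self, axis_apply_zero,
      axis_apply_zero]
  · rw [WilsonSiteRP.negReflect_apply_of_ne _ hk, WilsonRP.shift_apply_of_ne _ hk,
      axis_apply_of_ne c hk, axis_apply_of_ne _ hk]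

omit [MeasurableSpace G] [BorelSpace G] in
/-- `P_{c e₀}(ΘU) = P_{-c e₀}(U)` for the link reflection `Θ` and a temporal plane. [folklore] -/
theorem tplaq_timeReflect (hρ : Continuous ρ) (hq : q.1.1 = 0) (c : ZMod M) (U : GaugeConfig 4 M G) :
    WilsonRP.plaqRe ρ U.timeReflect ((Pi.single 0 c : Site 4 M), q) =
      WilsonRP.plaqRe ρ U (Pi.single 0 (-c), q) := by
  rw [WilsonRP.plaqRe_timeReflect ρ hρ]
  unfold WilsonRP.plaqReflect
  rw [if_pos (show (((Pi.single 0 c : Site 4 M), q) : Plaquette 4 M).2.1.1 = 0 from hq)]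
  show WilsonRP.plaqRe ρ U ((Site.shift (Pi.single 0 c : Site 4 M) 0).timeReflect, q) = _
  rw [timeReflect_shift_axis]

omit [MeasurableSpace G] [BorelSpace G] in
/-- `P_{c e₀}(Θ'U) = P_{-(c+1) e₀}(U)` for the site reflection `Θ'` and a temporal plane. [folklore] -/
theorem tplaq_negReflect (hρ : Continuous ρ) (hq : q.1.1 = 0) (c : ZMod M) (U : GaugeConfig 4 M G) :
    WilsonRP.plaqRe ρ U.negReflect ((Pi.single 0 c : Site 4 M), q) =
      WilsonRP.plaqRe ρ U (Pi.single 0 (-(c + 1)), q) := by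
  rw [WilsonSiteRP.plaqRe_negReflect ρ hρ]
  unfold WilsonSiteRP.sitePlaqReflect
  rw [if_pos (show (((Pi.single 0 c : Site 4 M), q) : Plaquette 4 M).2.1.1 = 0 from hq)]
  show WilsonRP.plaqRe ρ U ((Site.shift (Pi.single 0 c : Site 4 M) 0).negReflect, q) = _
  rw [negReflect_shift_axis]

omit [TopologicalSpace G] [IsTopologicalGroup G] [CompactSpace G] [MeasurableSpace G]
  [BorelSpace G] in
/-- The plaquette observable depends only on its four links; in particular it depends only on any
set of links containing them. [folklore] -/
theorem dependsOn_tplaq {s : Set (Edge 4 M)} (x : Site 4 M) (h1 : (x, q.1.1) ∈ s)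
    (h2 : (x.shift q.1.1, q.1.2) ∈ s) (h3 : (x.shift q.1.2, q.1.1) ∈ s) (h4 : (x, q.1.2) ∈ s) :
    DependsOn (fun U : GaugeConfig 4 M G => WilsonRP.plaqRe ρ U (x, q)) s := fun U V hUV => by
  simp only [WilsonRP.plaqRe, plaquetteHolonomy, hUV _ h1, hUV _ h2, hUV _ h3, hUV _ h4]

/-- Time coordinate of a natural-number axial site below the torus size. [folklore] -/
theorem val_axis_natCast {n : ℕ} (hn : n < M) : ((Pi.single 0 (n : ZMod M) : Site 4 M) 0).val = n := by
  rw [axis_apply_zero, ZMod.val_natCast, Nat.mod_eq_of_lt hn]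

/-- Casting complementary naturals: `x + y = M` gives `x = -y` in `ZMod M`. [folklore] -/
theorem natCast_eq_neg_natCast {x y : ℕ} (h : x + y = M) : ((x : ℕ) : ZMod M) = -((y : ℕ) : ZMod M) := by
  have h0 : ((x : ℕ) : ZMod M) + ((y : ℕ) : ZMod M) = 0 := by
    rw [← Nat.cast_add, h, ZMod.natCast_self]
  exact eq_neg_of_add_eq_zero_left h0

omit [Group G] [TopologicalSpace G] [IsTopologicalGroup G] [CompactSpace G] [MeasurableSpace G]
  [BorelSpace G] in
/-- Boundedness in the complex form used by the tree's reflection-positivity theorems. [folklore] -/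
theorem norm_ofReal_le_of_abs_le {H : GaugeConfig 4 M G → ℝ} (hb : ∃ C : ℝ, ∀ U, |H U| ≤ C) :
    ∃ C : ℝ, ∀ U, ‖((H U : ℝ) : ℂ)‖ ≤ C := by
  obtain ⟨C, hC⟩ := hb
  exact ⟨C, fun U => by rw [Complex.norm_real, Real.norm_eq_abs]; exact hC U⟩

variable [NeZero M]

/-- The real reading of a complex reflection-positivity statement: if
`0 ≤ ⟨conj F(ΘU) · F(U)⟩` for the complexification of a real `H`, then `0 ≤ ∫ H(ΘU) H(U)`. [folklore] -/
theorem integral_real_rp (β : ℝ) (Θ : GaugeConfig 4 M G → GaugeConfig 4 M G) (H : GaugeConfig 4 M G → ℝ)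
    (h : 0 ≤ wilsonExpectation ρ β fun U : GaugeConfig 4 M G =>
      (starRingEnd ℂ) ((H (Θ U) : ℝ) : ℂ) * ((H U : ℝ) : ℂ)) :
    0 ≤ ∫ U, H (Θ U) * H U ∂(wilsonMeasure (d := 4) (L := M) ρ β) := by
  have hre : (wilsonExpectation ρ β fun U : GaugeConfig 4 M G =>
      (starRingEnd ℂ) ((H (Θ U) : ℝ) : ℂ) * ((H U : ℝ) : ℂ)) =
      ((∫ U, H (Θ U) * H U ∂(wilsonMeasure (d := 4) (L := M) ρ β) : ℝ) : ℂ) := by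
    simp only [wilsonExpectation, Complex.conj_ofReal, ← Complex.ofReal_mul]
    exact integral_ofReal
  rw [hre] at h
  exact Complex.zero_le_real.1 h

/-- **Translation invariance of plaquette covariances.** [folklore] -/
theorem cov_tplaq_shift (β : ℝ) (x y v : Site 4 M) :
    cov[fun U => WilsonRP.plaqRe ρ U (x, q), fun U => WilsonRP.plaqRe ρ U (y, q);
        wilsonMeasure (d := 4) (L := M) ρ β] =
      cov[fun U => WilsonRP.plaqRe ρ U (x - v, q), fun U => WilsonRP.plaqRe ρ U (y - v, q);
        wilsonMeasure (d := 4) (L := M) ρ β] := by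
  conv_lhs => rw [← wilsonMeasure_map_torusConfigShift ρ β v]
  rw [covariance_map_equiv]
  simp only [Function.comp_def, tplaq_torusConfigShift]

/-- Bounded measurable observables of the (probability) Wilson state are in `L²`. [folklore] -/
theorem memLp_tplaq (hρ : Continuous ρ) (β : ℝ) (x : Site 4 M) :
    MemLp (fun U : GaugeConfig 4 M G => WilsonRP.plaqRe ρ U (x, q)) 2
      (wilsonMeasure (d := 4) (L := M) ρ β) := by
  haveI := isProbabilityMeasure_wilsonMeasure (d := 4) (L := M) ρ hρ β
  exact MemLp.of_bound (measurable_tplaq ρ hρ x).aestronglyMeasurable N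
    (ae_of_all _ fun U => by rw [Real.norm_eq_abs]; exact WilsonRP.abs_plaqRe_le ρ hρ U _)

/-! ### The axial covariance function `A_M(c) = Cov_{β,M}(P_0, P_{c e₀})`

It is introduced through the characterising hypothesis `hA` (no definition), so that the
statements below stay short. -/

variable {β : ℝ} {A : ZMod M → ℝ}
  (hA : ∀ c : ZMod M, A c = cov[fun U => WilsonRP.plaqRe ρ U ((Pi.single 0 0 : Site 4 M), q),
    fun U => WilsonRP.plaqRe ρ U ((Pi.single 0 c : Site 4 M), q); wilsonMeasure (d := 4) (L := M) ρ β])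
include hA

/-- `Cov(P_{a e₀}, P_{b e₀}) = A_M(b - a)`. [folklore] -/
theorem cov_axis_eq_tcov (a b : ZMod M) :
    cov[fun U => WilsonRP.plaqRe ρ U ((Pi.single 0 a : Site 4 M), q),
      fun U => WilsonRP.plaqRe ρ U ((Pi.single 0 b : Site 4 M), q); wilsonMeasure (d := 4) (L := M) ρ β] =
      A (b - a) := by
  rw [hA, cov_tplaq_shift ρ β _ _ (Pi.single 0 a : Site 4 M), axis_sub_axis, axis_sub_axis, sub_self]

/-- `A_M(-c) = A_M(c)`. [folklore] -/
theorem tcov_neg (c : ZMod M) : A (-c) = A c := by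
  rw [show -c = 0 - c by ring, ← cov_axis_eq_tcov ρ hA c 0, covariance_comm, hA]

/-- `A_M(c) ≤ A_M(0)` (`2 Cov(X, Y) ≤ Var X + Var Y` and translation invariance). [folklore] -/
theorem tcov_le_tcov_zero (hρ : Continuous ρ) (c : ZMod M) : A c ≤ A 0 := by
  haveI := isProbabilityMeasure_wilsonMeasure (d := 4) (L := M) ρ hρ β
  have hX := memLp_tplaq (q := q) ρ hρ β (Pi.single 0 (0 : ZMod M) : Site 4 M)
  have hY := memLp_tplaq (q := q) ρ hρ β (Pi.single 0 c : Site 4 M)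
  have hv := variance_nonneg ((fun U : GaugeConfig 4 M G =>
      WilsonRP.plaqRe ρ U ((Pi.single 0 (0 : ZMod M) : Site 4 M), q)) -
    fun U => WilsonRP.plaqRe ρ U ((Pi.single 0 c : Site 4 M), q)) (wilsonMeasure (d := 4) (L := M) ρ β)
  rw [variance_sub hX hY, ← covariance_self hX.aemeasurable, ← covariance_self hY.aemeasurable,
    cov_axis_eq_tcov ρ hA c c, sub_self, ← hA, ← hA] at hv
  linarith

/-- `0 ≤ A_M(0)` (a variance). [folklore] -/
theorem tcov_zero_nonneg (hρ : Continuous ρ) : 0 ≤ A 0 := by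
  rw [hA, covariance_self (measurable_tplaq ρ hρ _).aemeasurable]
  exact variance_nonneg _ _

/-! ### Reflection positivity: the abstract Cauchy–Schwarz step for axial plaquettes -/

/-- **From a reflection-positive cone to inequalities between axial covariances.** If `Θ` is a
measurable measure-preserving involution of the torus Wilson state, reflection positive on a cone
`D` (closed under `H + tK` and `H - c`), and `Θ` carries the axial plaquette at `a e₀` to the one
at `φ(a) e₀`, then for axial plaquettes `P_{a e₀}, P_{b e₀} ∈ D`:
`0 ≤ A_M(a - φ a)`, `0 ≤ A_M(b - φ b)` and `A_M(b - φ a)² ≤ A_M(a - φ a) A_M(b - φ b)`. [folklore] -/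
theorem tcov_rp (hρ : Continuous ρ) {Θ : GaugeConfig 4 M G → GaugeConfig 4 M G}
    (hΘm : Measurable Θ) (hΘμ : (wilsonMeasure (d := 4) (L := M) ρ β).map Θ = wilsonMeasure ρ β)
    (hΘΘ : ∀ U, Θ (Θ U) = U) {D : (GaugeConfig 4 M G → ℝ) → Prop}
    (hRP : ∀ H : GaugeConfig 4 M G → ℝ, Measurable H → (∃ C : ℝ, ∀ U, |H U| ≤ C) → D H →
      0 ≤ ∫ U, H (Θ U) * H U ∂(wilsonMeasure (d := 4) (L := M) ρ β))
    (hD : ∀ (H K : GaugeConfig 4 M G → ℝ) (t : ℝ), D H → D K → D fun U => H U + t * K U)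
    (hDc : ∀ (H : GaugeConfig 4 M G → ℝ) (c : ℝ), D H → D fun U => H U - c)
    {φ : ZMod M → ZMod M} (hφ : ∀ (a : ZMod M) (U : GaugeConfig 4 M G),
      WilsonRP.plaqRe ρ (Θ U) ((Pi.single 0 a : Site 4 M), q) =
        WilsonRP.plaqRe ρ U ((Pi.single 0 (φ a) : Site 4 M), q))
    {a b : ZMod M} (ha : D fun U => WilsonRP.plaqRe ρ U ((Pi.single 0 a : Site 4 M), q))
    (hb : D fun U => WilsonRP.plaqRe ρ U ((Pi.single 0 b : Site 4 M), q)) :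
    0 ≤ A (a - φ a) ∧ 0 ≤ A (b - φ b) ∧ A (b - φ a) ^ 2 ≤ A (a - φ a) * A (b - φ b) := by
  haveI := isProbabilityMeasure_wilsonMeasure (d := 4) (L := M) ρ hρ β
  have h := RPCauchySchwarz.covariance_rp_cauchySchwarz (μ := wilsonMeasure (d := 4) (L := M) ρ β)
    hΘm hΘμ hΘΘ hRP hD hDc (measurable_tplaq ρ hρ _) (measurable_tplaq ρ hρ _)
    ⟨N, fun U => WilsonRP.abs_plaqRe_le ρ hρ U _⟩ ⟨N, fun U => WilsonRP.abs_plaqRe_le ρ hρ U _⟩ ha hb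
  simp only [hφ] at h
  rwa [cov_axis_eq_tcov ρ hA (φ a) a, cov_axis_eq_tcov ρ hA (φ b) b, cov_axis_eq_tcov ρ hA (φ a) b] at h

/-! ### The three reflection-positive cones of the torus -/

/-- **Link reflection, even torus** (`θ t = 1 - t`, `β ≥ 0`): for `1 ≤ s, t` with
`s + 1, t + 1 ≤ M/2`, `0 ≤ A_M(2s)` and `A_M(s+t)² ≤ A_M(2s) A_M(2t)`. [folklore] -/
theorem tcov_link_even (hq : q.1.1 = 0) (hM : Even M) (hρ : Continuous ρ) (hβ : 0 ≤ β) {s t : ℕ}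
    (hs1 : 1 ≤ s) (hs : s + 1 ≤ M / 2) (ht1 : 1 ≤ t) (ht : t + 1 ≤ M / 2) :
    0 ≤ A ((2 * s : ℕ) : ZMod M) ∧
      A ((s + t : ℕ) : ZMod M) ^ 2 ≤ A ((2 * s : ℕ) : ZMod M) * A ((2 * t : ℕ) : ZMod M) := by
  haveI : Fact (1 < M) := ⟨by obtain ⟨r, hr⟩ := hM; have := NeZero.ne M; omega⟩
  -- the cone: observables of the positive links
  have hpos : ∀ {u : ℕ}, 1 ≤ u → u + 1 ≤ M / 2 →
      DependsOn (fun U : GaugeConfig 4 M G => WilsonRP.plaqRe ρ U ((Pi.single 0 (u : ZMod M) : Site 4 M), q))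
        {e : Edge 4 M | WilsonRP.IsPosEdge e} := by
    intro u hu1 hu
    have huM : u < M := by omega
    have hp : WilsonRP.IsPosPlaq ((Pi.single 0 (u : ZMod M) : Site 4 M), q) := by
      show 1 ≤ ((Pi.single 0 (u : ZMod M) : Site 4 M) 0).val ∧
        (if q.1.1 = 0 then ((Pi.single 0 (u : ZMod M) : Site 4 M) 0).val + 1 ≤ M / 2
          else ((Pi.single 0 (u : ZMod M) : Site 4 M) 0).val ≤ M / 2)
      rw [val_axis_natCast huM, if_pos hq]
      exact ⟨hu1, hu⟩
    obtain ⟨h1, h2, h3, h4⟩ := WilsonRP.isPosEdge_of_isPosPlaq hp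
    exact dependsOn_tplaq ρ _ h1 h2 h3 h4
  have h := tcov_rp ρ hA hρ (Θ := GaugeConfig.timeReflect) WilsonRP.measurable_timeReflect
    (RPCauchySchwarz.wilsonMeasure_map_timeReflect ρ hρ β) RPCauchySchwarz.timeReflect_timeReflect
    (D := fun H => DependsOn H {e : Edge 4 M | WilsonRP.IsPosEdge e})
    (fun H hH hHb hHD => integral_real_rp ρ β GaugeConfig.timeReflect H
      (wilsonExpectation_reflectionPositive_holds (d := 4) (L := M) ρ hM hρ hβ
        (fun U => ((H U : ℝ) : ℂ)) (Complex.measurable_ofReal.comp hH) (norm_ofReal_le_of_abs_le hHb)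
        (fun U V hUV => by
          have hUV' : H U = H V := hHD fun e he => hUV e he.1 he.2.1 he.2.2.1 he.2.2.2
          simp only [hUV'])))
    (fun H K c hH hK => RPCauchySchwarz.dependsOn_add_mul hH hK c)
    (fun H c hH => RPCauchySchwarz.dependsOn_sub_const hH c)
    (φ := fun a => -a) (fun a U => tplaq_timeReflect ρ hρ hq a U) (hpos hs1 hs) (hpos ht1 ht)
  have e1 : ((2 * s : ℕ) : ZMod M) = (s : ZMod M) - -(s : ZMod M) := by push_cast; ring
  have e2 : ((2 * t : ℕ) : ZMod M) = (t : ZMod M) - -(t : ZMod M) := by push_cast; ring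
  have e3 : ((s + t : ℕ) : ZMod M) = (t : ZMod M) - -(s : ZMod M) := by push_cast; ring
  rw [e1, e2, e3]
  exact ⟨h.1, h.2.2⟩

/-- **Site reflection, even torus** (`θ' t = -t`, any `β`): for `s + 1, t + 1 ≤ M/2`,
`0 ≤ A_M(2s+1)` and `A_M(s+t+1)² ≤ A_M(2s+1) A_M(2t+1)`. [folklore] -/
theorem tcov_site_even (hq : q.1.1 = 0) (hM : Even M) (hρ : Continuous ρ) {s t : ℕ}
    (hs : s + 1 ≤ M / 2) (ht : t + 1 ≤ M / 2) :
    0 ≤ A ((2 * s + 1 : ℕ) : ZMod M) ∧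
      A ((s + t + 1 : ℕ) : ZMod M) ^ 2 ≤ A ((2 * s + 1 : ℕ) : ZMod M) * A ((2 * t + 1 : ℕ) : ZMod M) := by
  haveI : Fact (1 < M) := ⟨by obtain ⟨r, hr⟩ := hM; have := NeZero.ne M; omega⟩
  have hpos : ∀ {u : ℕ}, u + 1 ≤ M / 2 →
      DependsOn (fun U : GaugeConfig 4 M G => WilsonRP.plaqRe ρ U ((Pi.single 0 (u : ZMod M) : Site 4 M), q))
        ((WilsonSiteRP.sitePosEdges ∪ WilsonSiteRP.sharedEdges : Finset (Edge 4 M)) :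
          Set (Edge 4 M)) := by
    intro u hu
    have huM : u < M := by omega
    have hp : WilsonSiteRP.IsSitePosPlaq ((Pi.single 0 (u : ZMod M) : Site 4 M), q) := by
      show if q.1.1 = 0 then ((Pi.single 0 (u : ZMod M) : Site 4 M) 0).val < M / 2
        else 1 ≤ ((Pi.single 0 (u : ZMod M) : Site 4 M) 0).val ∧
          ((Pi.single 0 (u : ZMod M) : Site 4 M) 0).val < M / 2
      rw [val_axis_natCast huM, if_pos hq]
      omega
    obtain ⟨h1, h2, h3, h4⟩ := WilsonSiteRP.edges_of_isSitePosPlaq hM hp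
    refine dependsOn_tplaq ρ _ ?_ ?_ ?_ ?_ <;>
      simp only [Finset.coe_union, Set.mem_union, Finset.mem_coe, WilsonSiteRP.mem_sitePosEdges,
        WilsonSiteRP.mem_sharedEdges] <;> assumption
  have h := tcov_rp ρ hA hρ (Θ := GaugeConfig.negReflect) WilsonSiteRP.measurable_negReflect
    (WilsonSiteRP.wilsonMeasure_map_negReflect ρ hM hρ β) WilsonSiteRP.negReflect_negReflect_config
    (D := fun H => DependsOn H
      ((WilsonSiteRP.sitePosEdges ∪ WilsonSiteRP.sharedEdges : Finset (Edge 4 M)) : Set (Edge 4 M)))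
    (fun H hH hHb hHD => integral_real_rp ρ β GaugeConfig.negReflect H
      (wilsonExpectation_siteReflectionPositive (d := 4) (L := M) ρ hM hρ β
        (fun U => ((H U : ℝ) : ℂ)) (Complex.measurable_ofReal.comp hH) (norm_ofReal_le_of_abs_le hHb)
        (fun U V hUV => by
          have hUV' : H U = H V := hHD hUV
          simp only [hUV'])))
    (fun H K c hH hK => RPCauchySchwarz.dependsOn_add_mul hH hK c)
    (fun H c hH => RPCauchySchwarz.dependsOn_sub_const hH c)
    (φ := fun a => -(a + 1)) (fun a U => tplaq_negReflect ρ hρ hq a U) (hpos hs) (hpos ht)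
  have e1 : ((2 * s + 1 : ℕ) : ZMod M) = (s : ZMod M) - -((s : ZMod M) + 1) := by push_cast; ring
  have e2 : ((2 * t + 1 : ℕ) : ZMod M) = (t : ZMod M) - -((t : ZMod M) + 1) := by push_cast; ring
  have e3 : ((s + t + 1 : ℕ) : ZMod M) = (t : ZMod M) - -((s : ZMod M) + 1) := by push_cast; ring
  rw [e1, e2, e3]
  exact ⟨h.1, h.2.2⟩

/-- **Mixed reflection, odd torus** (`θ t = 1 - t`, `M` odd, `M ≥ 3`, `β ≥ 0`): for
`1 ≤ a, b ≤ M/2`, `0 ≤ A_M(2a)` and `A_M(a+b)² ≤ A_M(2a) A_M(2b)`. Both the plaquettes next to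
the link hyperplane (`a` small) and those next to the site hyperplane (`a` close to `M/2`) are
covered. [folklore] -/
theorem tcov_odd (hq : q.1.1 = 0) (hM : Odd M) (hM3 : 3 ≤ M) (hρ : Continuous ρ) (hβ : 0 ≤ β)
    {a b : ℕ} (ha1 : 1 ≤ a) (ha : a ≤ M / 2) (hb1 : 1 ≤ b) (hb : b ≤ M / 2) :
    0 ≤ A ((2 * a : ℕ) : ZMod M) ∧
      A ((a + b : ℕ) : ZMod M) ^ 2 ≤ A ((2 * a : ℕ) : ZMod M) * A ((2 * b : ℕ) : ZMod M) := by
  haveI : Fact (1 < M) := ⟨by omega⟩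
  have hpos : ∀ {u : ℕ}, 1 ≤ u → u ≤ M / 2 →
      DependsOn (fun U : GaugeConfig 4 M G => WilsonRP.plaqRe ρ U ((Pi.single 0 (u : ZMod M) : Site 4 M), q))
        ((WilsonOddRP.oPosEdges ∪ WilsonOddRP.oSharedEdges : Finset (Edge 4 M)) : Set (Edge 4 M)) := by
    intro u hu1 hu
    have huM : u < M := by omega
    have hp : WilsonOddRP.IsOPosPlaq ((Pi.single 0 (u : ZMod M) : Site 4 M), q) := by
      show 1 ≤ ((Pi.single 0 (u : ZMod M) : Site 4 M) 0).val ∧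
        ((Pi.single 0 (u : ZMod M) : Site 4 M) 0).val ≤ M / 2
      rw [val_axis_natCast huM]
      exact ⟨hu1, hu⟩
    obtain ⟨h1, h2, h3, h4⟩ := WilsonOddRP.edges_of_isOPosPlaq hM hp
    refine dependsOn_tplaq ρ _ ?_ ?_ ?_ ?_ <;>
      simp only [Finset.coe_union, Set.mem_union, Finset.mem_coe, WilsonOddRP.mem_oPosEdges,
        WilsonOddRP.mem_oSharedEdges] <;> assumption
  have h := tcov_rp ρ hA hρ (Θ := GaugeConfig.timeReflect) WilsonRP.measurable_timeReflect
    (RPCauchySchwarz.wilsonMeasure_map_timeReflect ρ hρ β) RPCauchySchwarz.timeReflect_timeReflect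
    (D := fun H => DependsOn H
      ((WilsonOddRP.oPosEdges ∪ WilsonOddRP.oSharedEdges : Finset (Edge 4 M)) : Set (Edge 4 M)))
    (fun H hH hHb hHD => integral_real_rp ρ β GaugeConfig.timeReflect H
      (wilsonExpectation_oddReflectionPositive (d := 4) (L := M) ρ hM hM3 hρ hβ
        (fun U => ((H U : ℝ) : ℂ)) (Complex.measurable_ofReal.comp hH) (norm_ofReal_le_of_abs_le hHb)
        (fun U V hUV => by
          have hUV' : H U = H V := hHD hUV
          simp only [hUV'])))
    (fun H K c hH hK => RPCauchySchwarz.dependsOn_add_mul hH hK c)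
    (fun H c hH => RPCauchySchwarz.dependsOn_sub_const hH c)
    (φ := fun a => -a) (fun a U => tplaq_timeReflect ρ hρ hq a U) (hpos ha1 ha) (hpos hb1 hb)
  have e1 : ((2 * a : ℕ) : ZMod M) = (a : ZMod M) - -(a : ZMod M) := by push_cast; ring
  have e2 : ((2 * b : ℕ) : ZMod M) = (b : ZMod M) - -(b : ZMod M) := by push_cast; ring
  have e3 : ((a + b : ℕ) : ZMod M) = (b : ZMod M) - -(a : ZMod M) := by push_cast; ring
  rw [e1, e2, e3]
  exact ⟨h.1, h.2.2⟩

end Torus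

end AxialLogConvexity

end Summit.QuantumFields.YangMills.Theorems

end
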